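import Summits.ResolutionOfSingularities.ResolutionOfSingularities.Theorems.FrobeniusLadderFInjectiveMacaulayficationProp44T1FullGlue
import HarnessLib

/-!
# Cossart–Piltant 2008, Prop. 4.4 — the T1 line under the FULL-CHAIN ring contract v3′: the label-free point clause and the curve-successor clause

OURS (res-inputs-p-8b g2; critic R112 (E1)(E2)). CONTRACT v3′ (`false_of_fullChain_tau_one'`, signature 4da8544dee9e0b4d) asks, at a point
step, for the trichotomy of the near point in the charts of an ARBITRARY adapted label (`fullChain_hpt_cases` = σ′ handed over) and, after a
curve step with ANY adapted presentation `(y, v)` of the centre, for `u_{n+1} ∈ P_{n+1}` and the corrected strict transform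
(`fullChain_hPsucc_cv'` = κ + κ″ + a unit). AI-written; AI review weaker than expert review. `CossartPiltant2008_prop44`, T1 and the ring contract are NOT proved here;
resolution in dimension `≥ 4` / positive characteristic is NOT proved. No definitions, no named facts.
-/

noncomputable section

open CategoryTheory CategoryTheory.Limits AlgebraicGeometry TopologicalSpace IsLocalRing MvPolynomial
open Literature.AlgebraicGeometry.Resolution Scheme.IdealSheafData

namespace Summit.ResolutionOfSingularities.ResolutionOfSingularities.Theorems

namespace CP2008Prop44

universe u

set_option maxHeartbeats 800000 in
/-- **Point step: the TRICHOTOMY of the near point in the charts of an ARBITRARY adapted label** (CONTRACT v3′ clause `hpt_cases`, critic R112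
(E1)): σ′ (res-inputs-p-6's `IsBlowup.pointStep_trichotomy_of_stalkTau_eq_one'`) at level `n` of the T1 chain, handed over as is.
[cite: CossartPiltant2008, Lemma 4.3 (5); Lemma 4.5 (2)] -/
theorem fullChain_hpt_cases (Xs : ℕ → Scheme.{u})
    (hN : ∀ n, IsLocallyNoetherian (Xs n)) (hXreg : ∀ n, Scheme.IsRegular (Xs n))
    (π : ∀ n, Xs (n + 1) ⟶ Xs n) (Y : ∀ n, Closeds (Xs n)) (y : ∀ n, Xs (n + 1))
    (J : ∀ n, (Xs n).IdealSheafData) {μ : ℕ} (hμ : 1 ≤ μ)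
    (hy : ∀ n, π (n + 1) (y (n + 1)) = y n)
    (hmem : ∀ n, π n (y n) ∈ (Y n : Set (Xs n)))
    (hcl : ∀ n, IsClosed ({π n (y n)} : Set (Xs n)))
    (hYirr : ∀ n, IsIrreducible ((Y n : Closeds (Xs n)) : Set (Xs n)))
    (hYreg : ∀ n, Scheme.IsRegular (vanishingIdeal (Y n)).subscheme)
    (hYord : ∀ n, ∀ z ∈ (Y n : Set (Xs n)), idealOrder (J n) z = μ)
    (hπ : ∀ n, IsBlowup (π n) (vanishingIdeal (Y n)))
    (hJ : ∀ n, J (n + 1) = controlledTransform (π n) (vanishingIdeal (Y n)) (J n) μ)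
    (hbd : ∀ n (z : Xs n), idealOrder (J n) z ≤ μ)
    (hcodim : ∀ n, ∀ z ∈ (J n).support, 1 < Order.coheight z)
    (hd : ∀ n, (maximalIdeal ((Xs n).presheaf.stalk (π n (y n)))).spanFinrank = 3)
    (hnear : ∀ n, IsNear (π n) (vanishingIdeal (Y n)) (J n) μ (y n))
    (hτ : ∀ n, @stalkTau (Xs n) (J n) (π n (y n)) (hXreg n (π n (y n))) μ = 1)
    (hG : ∀ n, IsGRing ((Xs n).presheaf.stalk (π n (y n))))
    (hcoinc : ∀ n (z : Xs n), z ⤳ π n (y n) → idealOrder (J n) z = μ → z ∈ (Y n : Set (Xs n)))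
    (n : ℕ) (hptn : (Y n : Set (Xs n)) = {π n (y n)}) (c : Fin 3 → chainRing Xs π y n)
    (hc3 : Ideal.span {c 0, c 1, c 2} = maximalIdeal _)
    (had : ∀ G ∈ initialForms c (chainIdeal Xs π y J n) μ, ∃ a : ResidueField (chainRing Xs π y n), G = C a * X 0 ^ μ) :
    (Function.Surjective (ResidueField.map (chainMap Xs π y hy n)) ∧
      ∃ (a : chainRing Xs π y n) (y' w' : chainRing Xs π y (n + 1)), chainMap Xs π y hy n (c 0) = chainMap Xs π y hy n (c 1) * y' ∧ chainMap Xs π y hy n (c 2 - a * c 1) = chainMap Xs π y hy n (c 1) * w' ∧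
        Ideal.span {y', chainMap Xs π y hy n (c 1), w'} = maximalIdeal (chainRing Xs π y (n + 1))) ∨
    (¬ Function.Surjective (ResidueField.map (chainMap Xs π y hy n)) ∧
      ∃ (t : chainRing Xs π y (n + 1)) (Q : Polynomial (chainRing Xs π y n)) (y' : chainRing Xs π y (n + 1)),
        chainMap Xs π y hy n (c 0) = chainMap Xs π y hy n (c 1) * y' ∧ chainMap Xs π y hy n (c 2) = chainMap Xs π y hy n (c 1) * t ∧ Q.Monic ∧
        2 ≤ (Q.map (residue (chainRing Xs π y n))).natDegree ∧ Irreducible (Q.map (residue (chainRing Xs π y n))) ∧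
        (∀ G : Polynomial (chainRing Xs π y n), Polynomial.eval₂ (chainMap Xs π y hy n) t G ∈ maximalIdeal (chainRing Xs π y (n + 1)) ↔
          Q.map (residue (chainRing Xs π y n)) ∣ G.map (residue (chainRing Xs π y n))) ∧
        (∀ r : ResidueField (chainRing Xs π y (n + 1)), ∃ G : Polynomial (chainRing Xs π y n), residue (chainRing Xs π y (n + 1)) (Polynomial.eval₂ (chainMap Xs π y hy n) t G) = r) ∧
        Ideal.span {y', chainMap Xs π y hy n (c 1), Polynomial.eval₂ (chainMap Xs π y hy n) t Q} = maximalIdeal (chainRing Xs π y (n + 1))) ∨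
    (Function.Surjective (ResidueField.map (chainMap Xs π y hy n)) ∧
      ∃ (y' v' : chainRing Xs π y (n + 1)), chainMap Xs π y hy n (c 0) = chainMap Xs π y hy n (c 2) * y' ∧ chainMap Xs π y hy n (c 1) = chainMap Xs π y hy n (c 2) * v' ∧
        Ideal.span {y', v', chainMap Xs π y hy n (c 2)} = maximalIdeal (chainRing Xs π y (n + 1))) := by
  classical
  haveI := hN
  haveI hR : ∀ n, IsRegularLocalRing (chainRing Xs π y n) := fun n => hXreg n _
  have _h := hG; have _h := hbd; have _h := hmem; have _h := hYirr; have _h := hcodim; have _h := hcoinc; have _h := hYreg; have _h := hYord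
  have _h := hJ
  have rangeFin3 : ∀ {α : Type u} (c : Fin 3 → α), Set.range c = {c 0, c 1, c 2} := by
    intro α c
    ext a
    simp only [Set.mem_range, Set.mem_insert_iff, Set.mem_singleton_iff]
    constructor
    · rintro ⟨i, rfl⟩
      fin_cases i
      · exact Or.inl rfl
      · exact Or.inr (Or.inl rfl)
      · exact Or.inr (Or.inr rfl)
    · rintro (h | h | h) <;> exact ⟨_, h.symm⟩
  have hpt_P : stalkIdeal (vanishingIdeal (Y n)) (π n (y n)) = maximalIdeal _ := by
    have hYn : Y n = ⟨{π n (y n)}, hcl n⟩ := Closeds.ext hptn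
    rw [hYn, stalkIdeal_vanishingIdeal_singleton (hcl n)]
  have hcM : chainMap Xs π y hy n = stalkMapCongr (π n) (y n) (π (n + 1) (y (n + 1))) (hy n) := rfl
  have hc : Ideal.span (Set.range c) = maximalIdeal _ := by rw [rangeFin3]; exact hc3
  have hcY : Ideal.span (Set.range c) = stalkIdeal (vanishingIdeal (Y n)) (π n (y n)) := by rw [hc, hpt_P]
  have hadI : ∀ i, i ≠ 0 → IsAdapted c (chainIdeal Xs π y J n) μ i := bridge_isAdapted had
  rcases sigma'_congr (hπ n) hμ (hd n) hc hcY (hτ n) hadI (hnear n) (π (n + 1) (y (n + 1))) (hy n) (hd (n + 1)) with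
    ⟨a, c', h1, h0, h2, hgen', hsurj, -⟩ | ⟨t, Pq, c', h1, h0, ht, hmon, hP, hdeg, hirr, hres, hgen', -, hκ⟩ |
    ⟨c', h2, h0, h1, hgen', hsurj, -⟩
  · refine Or.inl ⟨hsurj, a, c' 0, c' 2, ?_, ?_, ?_⟩
    · rw [hcM]; exact h0
    · rw [hcM]; exact h2
    · rw [h1] at hgen'; rw [hcM]; exact hgen'
  · refine Or.inr (Or.inl ⟨not_surjective_residueField_map_of_two_le_natDegree _ hdeg hres, t, Pq, c' 0, ?_, ?_, hmon, hdeg, hirr,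
      ?_, ?_, ?_⟩)
    · rw [hcM]; exact h0
    · rw [hcM]; exact ht
    · rw [hcM]; exact hres
    · rw [hcM]; exact hκ
    · rw [h1, hP] at hgen'; rw [hcM]; exact hgen'
  · refine Or.inr (Or.inr ⟨hsurj, c' 0, c' 1, ?_, ?_, ?_⟩)
    · rw [hcM]; exact h0
    · rw [hcM]; exact h1
    · rw [h2] at hgen'; rw [hcM]; exact hgen'

set_option maxHeartbeats 800000 in
/-- **After a curve step the next curve centre is the corrected strict transform** (CONTRACT v3′ clause `hPsucc_cv`, any adapted presentation `(y, v)` of the centre): κ (p624926) names the chart,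
κ″ (p626243) gives `u_{n+1} ∈ P_{n+1}` and `β ∈ 𝔪_n` with `(y′ + φβ, u_{n+1}) = P_{n+1}`. [cite: CossartPiltant2008, Prop. 4.4 (proof, p. 11); Lemma 4.5 (2)] -/
theorem fullChain_hPsucc_cv' (Xs : ℕ → Scheme.{u})
    (hN : ∀ n, IsLocallyNoetherian (Xs n)) (hXreg : ∀ n, Scheme.IsRegular (Xs n))
    (π : ∀ n, Xs (n + 1) ⟶ Xs n) (Y : ∀ n, Closeds (Xs n)) (y : ∀ n, Xs (n + 1))
    (J : ∀ n, (Xs n).IdealSheafData) {μ : ℕ} (hμ : 1 ≤ μ)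
    (hy : ∀ n, π (n + 1) (y (n + 1)) = y n)
    (hmem : ∀ n, π n (y n) ∈ (Y n : Set (Xs n)))
    (hcl : ∀ n, IsClosed ({π n (y n)} : Set (Xs n)))
    (hYirr : ∀ n, IsIrreducible ((Y n : Closeds (Xs n)) : Set (Xs n)))
    (hYreg : ∀ n, Scheme.IsRegular (vanishingIdeal (Y n)).subscheme)
    (hYord : ∀ n, ∀ z ∈ (Y n : Set (Xs n)), idealOrder (J n) z = μ)
    (hπ : ∀ n, IsBlowup (π n) (vanishingIdeal (Y n)))
    (hJ : ∀ n, J (n + 1) = controlledTransform (π n) (vanishingIdeal (Y n)) (J n) μ)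
    (hbd : ∀ n (z : Xs n), idealOrder (J n) z ≤ μ)
    (hcodim : ∀ n, ∀ z ∈ (J n).support, 1 < Order.coheight z)
    (hd : ∀ n, (maximalIdeal ((Xs n).presheaf.stalk (π n (y n)))).spanFinrank = 3)
    (hnear : ∀ n, IsNear (π n) (vanishingIdeal (Y n)) (J n) μ (y n))
    (hτ : ∀ n, @stalkTau (Xs n) (J n) (π n (y n)) (hXreg n (π n (y n))) μ = 1)
    (hG : ∀ n, IsGRing ((Xs n).presheaf.stalk (π n (y n))))
    (hcoinc : ∀ n (z : Xs n), z ⤳ π n (y n) → idealOrder (J n) z = μ → z ∈ (Y n : Set (Xs n)))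
    (n : ℕ) (hnpt : (Y n : Set (Xs n)) ≠ {π n (y n)}) (hnpt1 : (Y (n + 1) : Set (Xs (n + 1))) ≠ {π (n + 1) (y (n + 1))})
    (un : chainRing Xs π y n) (u' : chainRing Xs π y (n + 1))
    (hEc : (stalkIdeal (vanishingIdeal (Y n)) (π n (y n))).map (chainMap Xs π y hy n) = Ideal.span {u'})
    (yv wv : chainRing Xs π y n) (y' : chainRing Xs π y (n + 1))
    (hyu : Ideal.span {yv, un} = stalkIdeal (vanishingIdeal (Y n)) (π n (y n)))
    (hgen : Ideal.span {yv, un, wv} = maximalIdeal _)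
    (had : ∀ G ∈ initialForms ![yv, un, wv] (chainIdeal Xs π y J n) μ, ∃ a : ResidueField (chainRing Xs π y n), G = C a * X 0 ^ μ)
    (hrel : chainMap Xs π y hy n yv = chainMap Xs π y hy n un * y') :
    u' ∈ stalkIdeal (vanishingIdeal (Y (n + 1))) (π (n + 1) (y (n + 1))) ∧
      ∃ β ∈ maximalIdeal (chainRing Xs π y n),
        Ideal.span {y' + chainMap Xs π y hy n β, u'} = stalkIdeal (vanishingIdeal (Y (n + 1))) (π (n + 1) (y (n + 1))) := by
  classical
  haveI := hN
  haveI hR : ∀ n, IsRegularLocalRing (chainRing Xs π y n) := fun n => hXreg n _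
  haveI hDom : ∀ n, IsDomain (chainRing Xs π y n) := fun n => isDomain_of_isRegularLocalRing _
  have _a := hbd; have _b := hnear; have _c := hG
  have range3 : ∀ {α : Type u} (a b c : α), Set.range ![a, b, c] = {a, b, c} := by
    intro α a b c
    ext t
    simp only [Set.mem_range, Set.mem_insert_iff, Set.mem_singleton_iff]
    constructor
    · rintro ⟨i, rfl⟩
      fin_cases i
      · exact Or.inl rfl
      · exact Or.inr (Or.inl rfl)
      · exact Or.inr (Or.inr rfl)
    · rintro (h | h | h)
      · exact ⟨0, by simp [h]⟩
      · exact ⟨1, by simp [h]⟩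
      · exact ⟨2, by simp [h]⟩
  have hcM : chainMap Xs π y hy n = stalkMapCongr (π n) (y n) (π (n + 1) (y (n + 1))) (hy n) := rfl
  obtain ⟨hπζ, hζnear, hYζ, hcohη, hcohζ⟩ :=
    tauOneChain_curveStep_succ Xs hN hXreg π Y y J hμ hy hmem hcl hYirr hYreg hYord hπ hJ hcodim hd hcoinc n hnpt hnpt1
  obtain ⟨hYη, -, -, -, -, -⟩ :=
    genericPoint_curve_facts (hXreg n) hμ (hcodim n) (hYirr n) (hYord n) (hmem n) (hcl n) (hd n) hnpt
  have hζq : (hYirr (n + 1)).genericPoint ⤳ π (n + 1) (y (n + 1)) :=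
    specializes_iff_mem_closure.mpr (hYζ ▸ hmem (n + 1))
  have hYη' : (Y n : Set (Xs n)) = closure {π n (hYirr (n + 1)).genericPoint} := by rw [hπζ]; exact hYη
  have hcohη' : Order.coheight (π n (hYirr (n + 1)).genericPoint) = 2 := by rw [hπζ]; exact hcohη
  set c : Fin 3 → chainRing Xs π y n := ![yv, un, wv] with hc_def
  have hc : Ideal.span (Set.range c) = maximalIdeal _ := by rw [hc_def, range3]; exact hgen
  have hcY : Ideal.span {c 0, c 1} = stalkIdeal (vanishingIdeal (Y n)) (π n (y n)) := by
    simp only [hc_def, Matrix.cons_val_zero, Matrix.cons_val_one]; exact hyu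
  have hadI : ∀ i, i ≠ 0 → IsAdapted c (chainIdeal Xs π y J n) μ i := bridge_isAdapted had
  obtain ⟨c', hmapY, h1, h0, h2, hgen', -, -⟩ :=
    IsBlowup.exists_curveStepData_of_adapted_congr (hXreg n) (hYreg n) (hπ n) hμ (hYord n) (hd n)
      hc hcY (hτ n) hadI (hnear n) (π (n + 1) (y (n + 1))) (hy n)
  simp only [hc_def, Matrix.cons_val_one, Matrix.cons_val_zero, Matrix.cons_val_two, Matrix.tail_cons, Matrix.head_cons] at h1 h0 h2 hmapY
  have hφu : chainMap Xs π y hy n un ≠ 0 := by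
    intro h0'
    rw [h1, ← hcM, h0', Set.insert_comm (c' 0) 0, Ideal.span, Submodule.span_insert_zero] at hgen'
    exact false_of_span_pair_eq_maximalIdeal hgen' (hd (n + 1))
  have h0c : chainMap Xs π y hy n yv = chainMap Xs π y hy n un * c' 0 := by rw [hcM]; exact h0
  have hy' : y' = c' 0 := mul_left_cancel₀ hφu (hrel.symm.trans h0c)
  rw [h1, h2, ← hy'] at hgen'
  have hrel' : stalkMapCongr (π n) (y n) (π (n + 1) (y (n + 1))) (hy n) yv =
      stalkMapCongr (π n) (y n) (π (n + 1) (y (n + 1))) (hy n) un * y' := by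
    rw [← hcM]; exact hrel
  obtain ⟨hmemu, β, hβ, hspan⟩ :=
    curveStep_succ_centre_congr (hXreg n) (hYreg n) (hπ n) hμ (hYord n) (π (n + 1) (y (n + 1)))
      (hy n) (hd n) (hd (n + 1)) hζq hcohζ hcohη' hYη' hζnear (Y' := Y (n + 1)) hYζ hgen hyu hrel' hgen'
  -- `u' = φ v · e` for a unit `e`
  haveI : IsDomain (chainRing Xs π y (n + 1)) := isDomain_of_isRegularLocalRing _
  have hsp : Ideal.span {chainMap Xs π y hy n un} = Ideal.span {u'} := by rw [← hEc, hcM]; exact hmapY.symm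
  obtain ⟨e, he⟩ := exists_unit_mul_eq_of_span_singleton_eq hsp
  rw [hcM] at he
  refine ⟨by rw [← he]; exact Ideal.mul_mem_right _ _ hmemu, β, hβ, ?_⟩
  rw [hcM, ← hspan]
  apply le_antisymm
  · rw [Ideal.span_le]
    intro t ht
    simp only [Set.mem_insert_iff, Set.mem_singleton_iff] at ht
    rcases ht with ht | ht <;> rw [ht]
    · exact Ideal.subset_span (by simp)
    · rw [← he]; exact Ideal.mul_mem_right _ _ (Ideal.subset_span (by simp))
  · rw [Ideal.span_le]
    intro t ht
    simp only [Set.mem_insert_iff, Set.mem_singleton_iff] at ht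
    rcases ht with ht | ht <;> rw [ht]
    · exact Ideal.subset_span (by simp)
    · have e2 : stalkMapCongr (π n) (y n) (π (n + 1) (y (n + 1))) (hy n) un = u' * ↑e⁻¹ := by
        rw [← he, mul_assoc, Units.mul_inv, mul_one]
      rw [e2]; exact Ideal.mul_mem_right _ _ (Ideal.subset_span (by simp))

end CP2008Prop44

end Summit.ResolutionOfSingularities.ResolutionOfSingularities.Theorems

end
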